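import Summits.BirchSwinnertonDyer.BirchSwinnertonDyer.Theorems.Rank2Observatory2DescClCurveCertE2Q2Sound
import HarnessLib

/-!
# BirchSwinnertonDyer — rank ≥ 2 observatory: KERNEL-2DESC-CL E2Q2 — the TWO-VIEW per-curve certificate over a two-prime record, part 6/8: valuations at the four auxiliary primes

HONEST FRAMING: per-curve certified theorems and census instruments; no claim on BSD in rank ≥ 2.

Part 6 of 8.  `log ord` of a checked two-view family element at the four auxiliary primes `W₁₁r, W₁₂r` (above
`q₁`) and `W₂₁r, W₂₂r` (above `q₂`): the element `q₁` (kind `1`) has `(−1, −1, 0, 0)`, the element `q₂` (kind `4`)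
has `(0, 0, −1, −1)`, a generic element is read on `X = m₁x` through `alpha_dispatch` (`q₁, q₂ ∤ m₁`) with the
certified `ordCheck` exponents and the `invCert` exclusions from `W₁₂r`, `W₂₂r`; and the height-one prime of a
tagged support code (`codePrime2Q`).  Text = the queued v2.3 part 3 (`…2DescClCurveCertE2Main`, `log_W₁/W₂_…`)
doubled to two primes over the registry-core lemmas of part 2.  New declarations only; sorry-free; axioms
`propext`, `Classical.choice`, `Quot.sound`.
[cite: Marcus2018, Ch. 3, Thm. 22] [cite: Cohen1993, §4.8.2] [cite: Cassels1991LecturesEllipticCurves, §15]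
-/

set_option linter.dupNamespace false

noncomputable section

open scoped Classical NumberField nonZeroDivisors

open Literature.NumberTheory.NumberFields Polynomial Module NumberField IsDedekindDomain Ideal

namespace Summit.BirchSwinnertonDyer.BirchSwinnertonDyer.Rank2Observatory.TwoDescCl

open TwoDescCubic ClFieldCertQ2

section Sound

variable {K : Type*} [Field K] [NumberField K] {θ : K} {F : ClFieldCertE2Q} {cc : ClCurveCertE2Q} {f : FamEntry2Q}

/-! ### The elements `q₁`, `q₂` of the family -/

/-- The element of kind `1` is literally `q₁`. -/
theorem eltOfQ_eq_q₁ (hθ : aeval θ (MonicCubic.poly F.fe.base.a F.fe.base.b F.fe.base.c) = 0)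
    (hE : F.fe.checkCoreE = true) (hK : F.checkConst = true) (h : famCheckE2Q F cc f = true) (h1 : f.kind = 1) :
    eltOfQ F hθ hE f.X f.Y = ((F.fe.base.q₁ : ℕ) : 𝓞 K) := by
  have hk := kind_of_famCheckE2Q h
  unfold famKindCheck2Q at hk
  rw [if_pos h1, decide_eq_true_eq] at hk
  have hX : lin hθ f.X.1 f.X.2.1 f.X.2.2 = (F.m₁ : 𝓞 K) * ((F.fe.base.q₁ : ℕ) : 𝓞 K) := by
    rw [hk]
    simp only
    rw [lin_const hθ]
    push_cast
    ring
  exact mul_left_cancel₀ (m₁_ne_zero_OQ hK) ((m₁_mul_eltOfQ hθ hE hK (tv_of_famCheckE2Q h)).trans hX)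

/-- The element of kind `4` is literally `q₂`. -/
theorem eltOfQ_eq_q₂ (hθ : aeval θ (MonicCubic.poly F.fe.base.a F.fe.base.b F.fe.base.c) = 0)
    (hE : F.fe.checkCoreE = true) (hK : F.checkConst = true) (h : famCheckE2Q F cc f = true) (h4 : f.kind = 4) :
    eltOfQ F hθ hE f.X f.Y = ((F.fe.base.q₂ : ℕ) : 𝓞 K) := by
  have hk := kind_of_famCheckE2Q h
  unfold famKindCheck2Q at hk
  have h1 : f.kind ≠ 1 := by omega
  rw [if_neg h1, if_pos h4, decide_eq_true_eq] at hk
  have hX : lin hθ f.X.1 f.X.2.1 f.X.2.2 = (F.m₁ : 𝓞 K) * ((F.fe.base.q₂ : ℕ) : 𝓞 K) := by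
    rw [hk]
    simp only
    rw [lin_const hθ]
    push_cast
    ring
  exact mul_left_cancel₀ (m₁_ne_zero_OQ hK) ((m₁_mul_eltOfQ hθ hE hK (tv_of_famCheckE2Q h)).trans hX)

/-- The generic-kind clauses: `X ∉ W₁₂`, `X ∉ W₂₂`, `ord_{q₁}`, `ord_{q₂}` of `|N(X)|`. -/
theorem generic_of_famCheckE2Q (h : famCheckE2Q F cc f = true) (h1 : f.kind ≠ 1) (h4 : f.kind ≠ 4) :
    invCert F.fe.base.a F.fe.base.b F.fe.base.c F.fe.base.w₁₂ f.X f.inv12 = true ∧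
      invCert F.fe.base.a F.fe.base.b F.fe.base.c F.fe.base.w₂₂ f.X f.inv22 = true ∧
      ordCheck F.fe.base.q₁ (normFormZ F.fe.base.a F.fe.base.b F.fe.base.c f.X.1 f.X.2.1 f.X.2.2).natAbs
        (f.e % 64) = true ∧
      ordCheck F.fe.base.q₂ (normFormZ F.fe.base.a F.fe.base.b F.fe.base.c f.X.1 f.X.2.1 f.X.2.2).natAbs
        (f.e / 64) = true := by
  have hk := kind_of_famCheckE2Q h
  unfold famKindCheck2Q at hk
  rw [if_neg h1, if_neg h4] at hk
  simp only [Bool.and_eq_true] at hk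
  exact ⟨hk.1.1.1, hk.1.1.2, hk.1.2, hk.2⟩

/-! ### `log ord` at `W₁₁r, W₁₂r, W₂₁r, W₂₂r` -/

/-- **`log ord_{W₁₁}(x)`** of a two-view family element (read on `X`; `q₁ ∤ m₁`). [cite: Marcus2018, Ch. 3, Thm. 22] -/
theorem log_W₁₁r_of_famCheckE2Q (hθ : aeval θ (MonicCubic.poly F.fe.base.a F.fe.base.b F.fe.base.c) = 0)
    (h3 : finrank ℚ K = 3) (hE : F.fe.checkCoreE = true) (hK : F.checkConst = true)
    (hpr : F.fe.primeListE.Forall Nat.Prime) (h : famCheckE2Q F cc f = true) :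
    WithZero.log ((F.fe.base.W₁₁r hθ h3 (F.fe.checkReg_of_coreE hE) (F.fe.base_primeList hpr)).valuation K
      ((eltOfQ F hθ hE f.X f.Y : 𝓞 K) : K)) = famL₁₁Q f := by
  have hR := F.fe.checkReg_of_coreE hE
  have hprb := F.fe.base_primeList hpr
  unfold famL₁₁Q
  by_cases h1 : f.kind = 1
  · rw [if_pos h1, eltOfQ_eq_q₁ hθ hE hK h h1]
    exact (log_q₁r hθ h3 hR hprb).1
  rw [if_neg h1]
  by_cases h4 : f.kind = 4
  · rw [if_pos h4, eltOfQ_eq_q₂ hθ hE hK h h4,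
      valuation_eq_one_of_not_mem _ (q₂_not_mem_of_q₁_mem_reg hR hprb _ (q₁_mem_W₁₁r hθ h3 hR hprb)),
      WithZero.log_one]
  rw [if_neg h4]
  obtain ⟨hinv12, -, hord₁, -⟩ := generic_of_famCheckE2Q h h1 h4
  have hdisp := (alpha_dispatch hθ (F.fe.d_pos hE) (F.fe.aeval_eta hθ hE) (F.bezout_of_const hK)
    (tv_of_famCheckE2Q h) (F.fe.base.W₁₁r hθ h3 hR hprb) (q₁_mem_W₁₁r hθ h3 hR hprb) (F.coprime_q₁ hK)).2
  unfold eltOfQ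
  rw [hdisp]
  exact log_W₁₁r_of_not_mem hθ h3 hR hprb (lin_not_mem_of_invCert hθ _ (W₁₂r_asIdeal hθ h3 hR hprb) hinv12)
    hord₁

/-- **`log ord_{W₁₂}(x)`** of a two-view family element. [cite: Marcus2018, Ch. 3, Thm. 22] -/
theorem log_W₁₂r_of_famCheckE2Q (hθ : aeval θ (MonicCubic.poly F.fe.base.a F.fe.base.b F.fe.base.c) = 0)
    (h3 : finrank ℚ K = 3) (hE : F.fe.checkCoreE = true) (hK : F.checkConst = true)
    (hpr : F.fe.primeListE.Forall Nat.Prime) (h : famCheckE2Q F cc f = true) :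
    WithZero.log ((F.fe.base.W₁₂r hθ h3 (F.fe.checkReg_of_coreE hE) (F.fe.base_primeList hpr)).valuation K
      ((eltOfQ F hθ hE f.X f.Y : 𝓞 K) : K)) = famL₁₂Q f := by
  have hR := F.fe.checkReg_of_coreE hE
  have hprb := F.fe.base_primeList hpr
  unfold famL₁₂Q
  by_cases h1 : f.kind = 1
  · rw [if_pos h1, eltOfQ_eq_q₁ hθ hE hK h h1]
    exact (log_q₁r hθ h3 hR hprb).2
  rw [if_neg h1]
  have hval : (F.fe.base.W₁₂r hθ h3 hR hprb).valuation K ((eltOfQ F hθ hE f.X f.Y : 𝓞 K) : K) = 1 := by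
    by_cases h4 : f.kind = 4
    · rw [eltOfQ_eq_q₂ hθ hE hK h h4]
      exact valuation_eq_one_of_not_mem _ (q₂_not_mem_of_q₁_mem_reg hR hprb _ (q₁_mem_W₁₂r hθ h3 hR hprb))
    obtain ⟨hinv12, -, -, -⟩ := generic_of_famCheckE2Q h h1 h4
    have hdisp := (alpha_dispatch hθ (F.fe.d_pos hE) (F.fe.aeval_eta hθ hE) (F.bezout_of_const hK)
      (tv_of_famCheckE2Q h) (F.fe.base.W₁₂r hθ h3 hR hprb) (q₁_mem_W₁₂r hθ h3 hR hprb) (F.coprime_q₁ hK)).2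
    unfold eltOfQ
    rw [hdisp]
    exact valuation_eq_one_of_invCert hθ _ (W₁₂r_asIdeal hθ h3 hR hprb) hinv12
  rw [hval, WithZero.log_one]

/-- **`log ord_{W₂₁}(x)`** of a two-view family element (read on `X`; `q₂ ∤ m₁`). [cite: Marcus2018, Ch. 3, Thm. 22] -/
theorem log_W₂₁r_of_famCheckE2Q (hθ : aeval θ (MonicCubic.poly F.fe.base.a F.fe.base.b F.fe.base.c) = 0)
    (h3 : finrank ℚ K = 3) (hE : F.fe.checkCoreE = true) (hK : F.checkConst = true)
    (hpr : F.fe.primeListE.Forall Nat.Prime) (h : famCheckE2Q F cc f = true) :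
    WithZero.log ((F.fe.base.W₂₁r hθ h3 (F.fe.checkReg_of_coreE hE) (F.fe.base_primeList hpr)).valuation K
      ((eltOfQ F hθ hE f.X f.Y : 𝓞 K) : K)) = famL₂₁Q f := by
  have hR := F.fe.checkReg_of_coreE hE
  have hprb := F.fe.base_primeList hpr
  unfold famL₂₁Q
  by_cases h1 : f.kind = 1
  · rw [if_pos h1, eltOfQ_eq_q₁ hθ hE hK h h1,
      valuation_eq_one_of_not_mem _ (q₁_not_mem_of_q₂_mem_reg hR hprb _ (q₂_mem_W₂₁r hθ h3 hR hprb)),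
      WithZero.log_one]
  rw [if_neg h1]
  by_cases h4 : f.kind = 4
  · rw [if_pos h4, eltOfQ_eq_q₂ hθ hE hK h h4]
    exact (log_q₂r hθ h3 hR hprb).1
  rw [if_neg h4]
  obtain ⟨-, hinv22, -, hord₂⟩ := generic_of_famCheckE2Q h h1 h4
  have hdisp := (alpha_dispatch hθ (F.fe.d_pos hE) (F.fe.aeval_eta hθ hE) (F.bezout_of_const hK)
    (tv_of_famCheckE2Q h) (F.fe.base.W₂₁r hθ h3 hR hprb) (q₂_mem_W₂₁r hθ h3 hR hprb) (F.coprime_q₂ hK)).2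
  unfold eltOfQ
  rw [hdisp]
  exact log_W₂₁r_of_not_mem hθ h3 hR hprb (lin_not_mem_of_invCert hθ _ (W₂₂r_asIdeal hθ h3 hR hprb) hinv22)
    hord₂

/-- **`log ord_{W₂₂}(x)`** of a two-view family element. [cite: Marcus2018, Ch. 3, Thm. 22] -/
theorem log_W₂₂r_of_famCheckE2Q (hθ : aeval θ (MonicCubic.poly F.fe.base.a F.fe.base.b F.fe.base.c) = 0)
    (h3 : finrank ℚ K = 3) (hE : F.fe.checkCoreE = true) (hK : F.checkConst = true)
    (hpr : F.fe.primeListE.Forall Nat.Prime) (h : famCheckE2Q F cc f = true) :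
    WithZero.log ((F.fe.base.W₂₂r hθ h3 (F.fe.checkReg_of_coreE hE) (F.fe.base_primeList hpr)).valuation K
      ((eltOfQ F hθ hE f.X f.Y : 𝓞 K) : K)) = famL₂₂Q f := by
  have hR := F.fe.checkReg_of_coreE hE
  have hprb := F.fe.base_primeList hpr
  unfold famL₂₂Q
  by_cases h4 : f.kind = 4
  · rw [if_pos h4, eltOfQ_eq_q₂ hθ hE hK h h4]
    exact (log_q₂r hθ h3 hR hprb).2
  rw [if_neg h4]
  have hval : (F.fe.base.W₂₂r hθ h3 hR hprb).valuation K ((eltOfQ F hθ hE f.X f.Y : 𝓞 K) : K) = 1 := by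
    by_cases h1 : f.kind = 1
    · rw [eltOfQ_eq_q₁ hθ hE hK h h1]
      exact valuation_eq_one_of_not_mem _ (q₁_not_mem_of_q₂_mem_reg hR hprb _ (q₂_mem_W₂₂r hθ h3 hR hprb))
    obtain ⟨-, hinv22, -, -⟩ := generic_of_famCheckE2Q h h1 h4
    have hdisp := (alpha_dispatch hθ (F.fe.d_pos hE) (F.fe.aeval_eta hθ hE) (F.bezout_of_const hK)
      (tv_of_famCheckE2Q h) (F.fe.base.W₂₂r hθ h3 hR hprb) (q₂_mem_W₂₂r hθ h3 hR hprb) (F.coprime_q₂ hK)).2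
    unfold eltOfQ
    rw [hdisp]
    exact valuation_eq_one_of_invCert hθ _ (W₂₂r_asIdeal hθ h3 hR hprb) hinv22
  rw [hval, WithZero.log_one]

/-! ### The code primes of the support -/

variable (F) in
/-- The height-one prime of a tagged support code (`true` = `α`-registry, `false` = `η`-registry). -/
def codePrime2Q (hθ : aeval θ (MonicCubic.poly F.fe.base.a F.fe.base.b F.fe.base.c) = 0) (h3 : finrank ℚ K = 3)
    (hE : F.fe.checkCoreE = true) (hpr : F.fe.primeListE.Forall Nat.Prime) (bc : (Bool × PCode) × FamEntry2Q) :
    HeightOneSpectrum (𝓞 K) :=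
  if bc.1.1 = true then codePrimeR hθ h3 (F.fe.checkReg_of_coreE hE) (F.fe.base_primeList hpr) bc.1.2
  else F.fe.codePrimeEta hθ h3 hE hpr bc.1.2

/-! ### The square rescaling of the kill relation -/

omit [NumberField K] in
/-- `m₁ · m₁^{n} = (r₁^{n+1})²` in `K`. [folklore] -/
theorem m₁_mul_pow_eq_sq (F : ClFieldCertE2Q) (n : ℕ) :
    (F.m₁ : K) * (F.m₁ : K) ^ n = ((F.r₁ : K) ^ (n + 1)) ^ 2 := by
  rw [← pow_succ', ClFieldCertE2Q.m₁, Nat.cast_pow, ← pow_mul, ← pow_mul, Nat.mul_comm]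

end Sound

end Summit.BirchSwinnertonDyer.BirchSwinnertonDyer.Rank2Observatory.TwoDescCl
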